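import Summits.BirchSwinnertonDyer.BirchSwinnertonDyer.Theorems.TeichmullerTwistDescentKOfTameTypeCentral
import Summits.BirchSwinnertonDyer.BirchSwinnertonDyer.Theorems.TeichmullerTwistDescentKFiveOfBorel
import Summits.BirchSwinnertonDyer.BirchSwinnertonDyer.Theorems.TeichmullerTwistDescentKFiveOfCarrier
import Summits.BirchSwinnertonDyer.BirchSwinnertonDyer.Theorems.TeichmullerTwistDescentWeightExclusionFive
import Literature.NumberTheory.EllipticCurves.ManinConstantClassCertificateTwist
import HarnessLib

/-!
# Route `TeichmullerTwistDescent`: «K₅» — the twisted period-lattice saturation `Λ(f) ⊆ g(χ)·Λ(f ⊗ χ)` for EVERY additive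
# (G)-ordinary unstarred prime `p ≥ 5` with `E[p]` irreducible (Kummer corner `(5, III)`, `(7, II)` and the cell `(7, IV)` included),
# from the same five named published inputs as K

Cell `pub/bsd-wall` (D-0145 line route-BirchSwinnertonDyer-TeichmullerTwistDescent, OPEN rev 8), seat `bsd-line-ttd-p1` (prover 1/2,
g29).  THEOREMS ONLY; `--supports stmt-BirchSwinnertonDyer-24306`.  BSD is not proved by this file; no item is closed by it: the corner
items 24306 / 24307 / 23883 are NOT proved (see the obstruction below), and K₅ is CONDITIONAL on five named hypotheses (modularity
and four cite-only published statements).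

WHAT.  The crux K `TwistedPeriodLatticeSaturation` (stmt-BirchSwinnertonDyer-25368) reads «for the optimal curve `W`, additive and
(G)-ordinary at `p ≥ 11` with `ord_pΔ_min ≤ 4` and `E[p]` irreducible, and `χ` the quadratic character mod `p`: `Λ(f_W) ⊆ g(χ)·Λ(f_W ⊗ χ)`»;
the K-line (g24–g28) proved it from five named inputs (`KOfNamedInputs.twistedPeriodLatticeSaturation_of_named_inputs`).  Following the
route pen's key (EVENT88: transfer the five-print argument to the Kummer corner `(p, e) ∈ {(5, 4), (7, 6)}`), this file proves the SAME
STATEMENT WITH `11 ≤ p` REPLACED BY `5 ≤ p` («K₅») from the same five inputs: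

* `exists_ratFunctional_of_tameTypeCentral` — (I1ᴷ/I1ℚ) at an instance `p ≥ 5`: from the central-character-pinned CDT tame type of
  the full-level homology, a nonzero equivariant `ℚ_p`-valued functional on `Λ_Q(f_D)` to `coordRep(ω̃^{p−1−b}, ω̃ᵇ) ⊗ ℚ_p`,
  `b = tameExponent p W` (twin of `KOfTameType.tamePrincipalSeriesFunctionalOverField_of_tameTypeCentral`, whose proof already ran on
  `5 ≤ p`; Eichler–Shimura base change `ℚ_p ⊗ Λ_Q`, Maschke, isotypy);
* `twistedPeriodLatticeSaturation_five_of_named_inputs` — **K₅**: K's text with `5 ≤ p`, from `exists_isNewformOf`,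
  `fullLevelHomology_isIsotypic_tamePrincipalSeries_of_central`, `fullLevelHomology_twist_isModular_of_eigenMap_signed`,
  `Kraus1997.propOne_inertiaShape_of_ordinary`, `edixhoven1992_serreWeight_le_weight_of_newform` — chain: type ⟹ rational functional ⟹
  integral (`KFive.exists_integral_of_rat`) ⟹ Borel eigenfunctional (`KFive.exists_borel_of_functional`) ⟹ with (W‴)₅
  (`WeightExclusionFive.eq_zero_of_eigenMap_of_five_le`) the integral carrier functional with socle clause
  (`KFive.exists_integralFunctional_of_borel_of_weightExclusion`) ⟹ saturation (`KFive.saturation_at_of_integralFunctional`);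
* `twistedPeriodLatticeSaturation_of_corner_of_named_inputs` — the Kummer-corner reading on CORNER's own binders
  (`(p, ord_pΔ) ∈ {(5, 3), (7, 2)}`, additive, `E[p]` irreducible, (G)-ordinary; the `ℚ_p`-rational `p`-torsion point is not used).

THE OBSTRUCTION (why this does not close the corner; seat memo KLINE-CORNER-ttdp1g29.md).  GE11 followed from K by the glue 25371: Néron
lattice of the `p*`-twist (NTL, proved), modularity, and Edixhoven 1991 Thm. 3 for the STARRED optimal partner (types IV*/III*/II*) —
typed `7 < p` (`edixhoven_not_dvd_maninConstant_of_kodairaSymbol_ne`).  At `p = 7` the partner `(7, IV*)` (`e = 3`) is inside Edixhoven's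
method but outside his printed range; at `p = 5` the partner `(5, III*)` (`e = 4 = p − 1`) is outside both.  So K₅ reduces the corner's
Manin unit F″-free to the starred partner's Manin unit and no further.
-/

set_option autoImplicit false
-- single-conjunct summit: `Summit.BirchSwinnertonDyer.BirchSwinnertonDyer.…` repeats the name by design
set_option linter.dupNamespace false

noncomputable section

open scoped Pointwise MatrixGroups TensorProduct

open Function CongruenceSubgroup
open Literature.RepresentationTheory.FiniteGroups Literature.RepresentationTheory.FiniteGroups.GL2
  Literature.NumberTheory.EllipticCurves.ModularForms
open Literature.NumberTheory.EllipticCurves (Kato2004.teichmullerChar)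
open Literature.NumberTheory.ModularSymbols Literature.NumberTheory.ModularSymbols.FullLevel
open Literature.Algebra.Homology
open Literature.NumberTheory.Automorphic (TwistedQuotient.resScalars TwistedQuotient.resScalars_apply)
open Literature.NumberTheory.Automorphic (edixhoven1992_serreWeight_le_weight_of_newform)

namespace Summit.BirchSwinnertonDyer.BirchSwinnertonDyer.Theorems.TeichmullerTwistDescent

open WeierstrassCurve Literature.NumberTheory.EllipticCurves
open KOfTameType KOfCarrier

namespace KFive

section TypeStep

variable (p M : ℕ) [hp : Fact p.Prime] [NeZero M] (hpM : Nat.Coprime p M)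
  [Fintype (diagTorus (ZMod p))] [Invertible (Fintype.card (diagTorus (ZMod p)) : ℤ_[p])]

set_option maxHeartbeats 400000 in
/-- **(I1ℚ) at an instance `p ≥ 5` from the central-character-pinned TYPE of the full-level homology** (twin of
`KOfTameType.tamePrincipalSeriesFunctionalOverField_of_tameTypeCentral` with `11 ≤ p` weakened to `5 ≤ p`, conclusion over `ℚ_p`): for `W`
of conductor `p²M`, additive and (G)-ordinary at `p` with `ord_pΔ_min ≤ 4`, `E[p]` irreducible, and a datum `D` at level `p²M`, there is a
NONZERO `ℤ_p`-linear `Ψ : Λ_Q(f_D) → coordRep(ω̃^{p−1−b}, ω̃ᵇ) ⊗ ℚ_p` equivariant on spreads, `b = tameExponent p W`.  Proof as in the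
tree: `V = ℚ_p ⊗ Λ_Q(f_D)` with the base-changed translation action is a Hecke-trivialised quotient of the carrier with trivial central
action, hence isotypic of the tame type (the fact, binders `5 ≤ p`, `v_pΔ ≠ 6`, `e·b = p − 1` from `TameExponent` at `p ≥ 5`); Maschke and
isotypy give an intertwiner to the type seeing a nonzero vector.  BSD is not proved by this.
[cite: ConradDiamondTaylor1999, Lemma 4.2.4 (2), §5.3, Lemma 7.1.3 (2)] [cite: AshStevens1986, §1 (1.2)–(1.4)]
[cite: SerreLinearRepresentations1977, §2.6 Thm. 8, §15.2] -/
theorem exists_ratFunctional_of_tameTypeCentral (hT : fullLevelHomology_isIsotypic_tamePrincipalSeries_of_central)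
    (W : WeierstrassCurve ℚ) [W.IsElliptic] [W.IsGloballyMinimal] (hN : W.conductorNorm ℤ = p ^ 2 * M)
    (D : ModularParametrizationData W (p ^ 2 * M)) (hp5 : 5 ≤ p) (hadd : Rank1Residual.Addv W p)
    (hGo : Summit.BirchSwinnertonDyer.Rank1Residual.Additive.TypeGOrd W p) (hV4 : padicValInt p W.minimalDiscriminantInt ≤ 4) :
    ∃ Ψ : spreadLattice ℤ_[p] p M hpM D.f →ₗ[ℤ_[p]] (Option (ZMod p) → ℚ_[p]),
      IsEquivariantOnSpread ℤ_[p] p M hpM D.f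
        (TwistedQuotient.resScalars ℤ_[p]
          (coordRep (reduceChar ℚ_[p] (Kato2004.teichmullerChar p ^ (p - 1 - tameExponent p W)))
            (reduceChar ℚ_[p] (Kato2004.teichmullerChar p ^ tameExponent p W)))) Ψ ∧
      Ψ ≠ 0 := by
  haveI : NeZero (p ^ 2 * M) := neZero_sq_mul p M
  -- the fact's hypotheses from the prefix
  have hPGO : W.HasPotentiallyGoodOrdinaryReductionAtPrime p :=
    W.hasPotentiallyGoodOrdinaryReductionAtPrime_of_forall_intermediateField p Fact.out hGo
  have hv6 : padicValInt p W.minimalDiscriminantInt ≠ 6 := by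
    rcases TameExponent.padicValInt_mem W p hp5 hadd hV4 with h | h | h <;> omega
  have heb : 12 / Nat.gcd 12 (padicValInt p W.minimalDiscriminantInt) * tameExponent p W = p - 1 :=
    TameExponent.semistabilityIndex_mul_tameExponent W p hp5 hadd hGo hV4
  -- the lattice, its translation representation and the base change to `ℚ_p`
  haveI := KOfPrincipalSeriesFunctional.moduleFinite_spreadLattice p M hpM D.f
  obtain ⟨ρ, hρ⟩ := exists_translationRep p M hpM D.f
  obtain ⟨σ, hσ⟩ : ∃ σ : Representation ℚ_[p] (GL (Fin 2) (ZMod p)) (ℚ_[p] ⊗[ℤ_[p]] spreadLattice ℤ_[p] p M hpM D.f),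
      ∀ (g : GL (Fin 2) (ZMod p)) (a : ℚ_[p]) (x : spreadLattice ℤ_[p] p M hpM D.f),
        σ g (a ⊗ₜ[ℤ_[p]] x) = a ⊗ₜ[ℤ_[p]] ρ g x :=
    exists_baseChangeRep (A := ℚ_[p]) ρ
  -- `Φ = (1 ⊗ ·) ∘ spreadElt`
  let ι : spreadLattice ℤ_[p] p M hpM D.f →ₗ[ℤ_[p]] ℚ_[p] ⊗[ℤ_[p]] spreadLattice ℤ_[p] p M hpM D.f :=
    TensorProduct.mk ℤ_[p] ℚ_[p] (spreadLattice ℤ_[p] p M hpM D.f) 1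
  let Φ : H1carrier ℤ_[p] p M →ₗ[ℤ_[p]] ℚ_[p] ⊗[ℤ_[p]] spreadLattice ℤ_[p] p M hpM D.f :=
    ι.comp (LinearMap.rangeRestrict (spreadPeriod ℤ_[p] p M hpM D.f))
  have hΦ : ∀ z, Φ z = (1 : ℚ_[p]) ⊗ₜ[ℤ_[p]] spreadElt ℤ_[p] p M hpM D.f z := fun z => rfl
  -- `spreadElt` intertwines the carrier action with `ρ`
  have hρ' : ∀ (g : GL (Fin 2) (ZMod p)) (z : H1carrier ℤ_[p] p M),
      spreadElt ℤ_[p] p M hpM D.f (H1carrierRep ℤ_[p] p M g z) = ρ g (spreadElt ℤ_[p] p M hpM D.f z) := by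
    intro g z
    rw [spreadElt_H1carrierRep]
    exact Subtype.ext (hρ g (spreadElt ℤ_[p] p M hpM D.f z)).symm
  -- the centre acts trivially on `V`
  have hZ : ∀ (a : (ZMod p)ˣ) (v : ℚ_[p] ⊗[ℤ_[p]] spreadLattice ℤ_[p] p M hpM D.f),
      σ (diagElt (ZMod p) a a) v = v := baseChange_central_eq p M hpM D.f ρ hρ σ hσ
  -- equivariance of `Φ`
  have hG : ∀ (g : GL (Fin 2) (ZMod p)) (z : H1carrier ℤ_[p] p M), Φ (H1carrierRep ℤ_[p] p M g z) = σ g (Φ z) := by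
    intro g z
    rw [hΦ, hΦ, hρ', hσ]
  -- Hecke trivialisation of `Φ` at `W`
  have hTq : ∀ (q : ℕ) [NeZero q] (hq : q.Prime) (hqp : q ≠ p) (z : H1carrier ℤ_[p] p M),
      Φ (heckeT ℤ_[p] p M hq hqp z) = ((W.LFunction q : ℤ) : ℚ_[p]) • Φ z := by
    intro q _ hq hqp z
    have hTf : HeckeRing0.toEnd (p ^ 2 * M) 2 (HeckeRing0.T (p ^ 2 * M) 2 q hq) D.f = ((W.LFunction q : ℤ) : ℂ) • D.f := by
      have hcoef : (UpperHalfPlane.qExpansion 1 ⇑D.f).coeff q = ((W.LFunction q : ℤ) : ℂ) := D.isNewformOf.2 q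
      rw [HeckeRing0.toEnd_T, D.isNewformOf.1.heckeT_eq_coeff_smul hq, hcoef]
    have hsm : spreadElt ℤ_[p] p M hpM D.f (heckeT ℤ_[p] p M hq hqp z) =
        ((W.LFunction q : ℤ) : ℤ_[p]) • spreadElt ℤ_[p] p M hpM D.f z :=
      Subtype.ext (by rw [coe_spreadElt, spreadPeriod_heckeT ℤ_[p] p M hpM hq hqp hTf z, Submodule.coe_smul, coe_spreadElt])
    rw [hΦ, hΦ, hsm, Int.cast_smul_eq_zsmul, TensorProduct.tmul_smul, Int.cast_smul_eq_zsmul]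
  -- the image of `Φ` spans `V`
  have hspan : Submodule.span ℚ_[p] (Set.range Φ) = ⊤ := by
    rw [eq_top_iff]
    rintro v -
    induction v using TensorProduct.induction_on with
    | zero => exact Submodule.zero_mem _
    | tmul a F =>
      obtain ⟨z, hz⟩ := F.2
      have hF : F = spreadElt ℤ_[p] p M hpM D.f z := Subtype.ext hz.symm
      have hmem : (1 : ℚ_[p]) ⊗ₜ[ℤ_[p]] F ∈ Submodule.span ℚ_[p] (Set.range Φ) :=
        Submodule.subset_span ⟨z, by rw [hΦ, hF]⟩
      have := Submodule.smul_mem _ a hmem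
      rwa [TensorProduct.smul_tmul', smul_eq_mul, mul_one] at this
    | add x y hx hy => exact Submodule.add_mem _ hx hy
  -- the fact: `V` is isotypic of the tame principal-series type
  have hiso := hT p M W (tameExponent p W) hp5 hpM hN hPGO hv6 heb ℚ_[p]
    (ℚ_[p] ⊗[ℤ_[p]] spreadLattice ℤ_[p] p M hpM D.f) σ Φ hZ hG hTq hspan
  -- a nonzero vector of `V` in the image of `Φ`
  obtain ⟨z₀, hz₀⟩ := exists_spreadElt_ne_zero p M hpM D.f D.isNewformOf.1 D.isNewformOf.coeffField_eq_bot
  have hΦz₀ : Φ z₀ ≠ 0 := by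
    rw [hΦ]
    exact one_tmul_ne_zero (R := ℤ_[p]) (A := ℚ_[p]) (IsFractionRing.injective ℤ_[p] ℚ_[p]) hz₀
  -- Maschke + isotypy: a `ℚ_p[GL₂(𝔽_p)]`-linear map to the type seeing `Φ z₀`
  haveI : IsSemisimpleModule (MonoidAlgebra ℚ_[p] (GL (Fin 2) (ZMod p))) σ.asModule := inferInstance
  obtain ⟨θ, hθ⟩ := exists_linearMap_apply_ne_zero_of_isIsotypicOfType hiso (v := (Φ z₀ : σ.asModule)) hΦz₀
  -- back to an intertwining `ℚ_p`-linear map (kept opaque)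
  obtain ⟨θ', hθ'⟩ : ∃ θ' : σ.IntertwiningMap
      (coordRep (reduceChar ℚ_[p] (Kato2004.teichmullerChar p ^ (p - 1 - tameExponent p W)))
        (reduceChar ℚ_[p] (Kato2004.teichmullerChar p ^ tameExponent p W))), ∀ v, θ' v = θ v :=
    ⟨(Representation.IntertwiningMap.equivLinearMapAsModule _ _).symm θ, fun v => rfl⟩
  -- the functional `Ψ = θ' ∘ (1 ⊗ ·)`, kept opaque
  obtain ⟨Ψ, hΨ⟩ : ∃ Ψ : spreadLattice ℤ_[p] p M hpM D.f →ₗ[ℤ_[p]] (Option (ZMod p) → ℚ_[p]),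
      ∀ F, Ψ F = θ' ((1 : ℚ_[p]) ⊗ₜ[ℤ_[p]] F) :=
    ⟨(θ'.toLinearMap.restrictScalars ℤ_[p]).comp ι, fun F => rfl⟩
  refine ⟨Ψ, ?_, ?_⟩
  · -- equivariance (no `rw` with a `Subtype.mk`-headed pattern: go through `ρ g F`)
    intro F g
    have hFg : (⟨funTranslate p g F.1, spreadLattice_translate_mem ℤ_[p] p M hpM D.f g F.2⟩ :
        spreadLattice ℤ_[p] p M hpM D.f) = ρ g F := Subtype.ext (hρ g F).symm
    have key : Ψ (ρ g F) =
        coordRep (reduceChar ℚ_[p] (Kato2004.teichmullerChar p ^ (p - 1 - tameExponent p W)))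
          (reduceChar ℚ_[p] (Kato2004.teichmullerChar p ^ tameExponent p W)) g (Ψ F) := by
      have h2 := Representation.IntertwiningMap.isIntertwining _ _ θ' g ((1 : ℚ_[p]) ⊗ₜ[ℤ_[p]] F)
      rw [hσ g 1 F] at h2
      rw [hΨ, hΨ]
      exact h2
    rw [TwistedQuotient.resScalars_apply, ← key]
    exact congrArg Ψ hFg
  · -- nonvanishing
    intro h0
    apply hθ
    have h1 : Ψ (spreadElt ℤ_[p] p M hpM D.f z₀) = 0 := by rw [h0, LinearMap.zero_apply]
    rw [hΨ, hθ', ← hΦ] at h1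
    exact h1

end TypeStep

/-! ### K₅ from the five named inputs -/

/-- **K₅ — the crux text of `TwistedPeriodLatticeSaturation` with `11 ≤ p` replaced by `5 ≤ p`, from the five named inputs of K**:
modularity `exists_isNewformOf` (C13), the central-character-pinned CDT tame type `fullLevelHomology_isIsotypic_tamePrincipalSeries_of_central`,
the signed BDJ/Ash–Stevens weight statement `fullLevelHomology_twist_isModular_of_eigenMap_signed`, Kraus 1997 Prop. 1
`Kraus1997.propOne_inertiaShape_of_ordinary`, Edixhoven 1992 Thm. 4.5 `edixhoven1992_serreWeight_le_weight_of_newform`.  For every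
globally minimal elliptic `W/ℚ`, prime `p ≥ 5` with `p² ∣ N`, additive and (G)-ordinary at `p` with `ord_pΔ_min ≤ 4` (at `p = 5`: III; at
`p = 7`: II or IV; at `p ≥ 11`: II, III, IV), `E[p]` irreducible, `D` a lattice-optimal modular parametrisation datum at level `N`, and
`χ` primitive quadratic mod `p`: `Λ(f_D) ⊆ g(χ)·Λ(f_D ⊗ χ)`.  CONDITIONAL on the five named hypotheses; BSD is not proved by this; the
corner items are NOT closed by this (module docstring).
[cite: EdixhovenManin1991, §4] [cite: ConradDiamondTaylor1999, Lemma 4.2.4 (2), §5.3] [cite: BuzzardDiamondJarvis2010, §2 Prop. 2.5, Cor. 2.10 (2)]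
[cite: Kraus1997Dissertationes, Prop. 1] [cite: Edixhoven1992, Thm. 4.5] [cite: EmertonGeeSavitt2015, Lemma 4.1.1] -/
theorem twistedPeriodLatticeSaturation_five_of_named_inputs (hnf : exists_isNewformOf)
    (hT : fullLevelHomology_isIsotypic_tamePrincipalSeries_of_central)
    (hWt : fullLevelHomology_twist_isModular_of_eigenMap_signed)
    (hKr : Kraus1997.propOne_inertiaShape_of_ordinary) (hEd : edixhoven1992_serreWeight_le_weight_of_newform) :
    ∀ (W : WeierstrassCurve ℚ) [W.IsElliptic] [W.IsGloballyMinimal] (p : ℕ) [Fact p.Prime] [NeZero (W.conductorNorm ℤ)]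
      (D : ModularParametrizationData W (W.conductorNorm ℤ)) (hsq : p ^ 2 ∣ W.conductorNorm ℤ),
      5 ≤ p → Rank1Residual.Addv W p → Rank1Residual.Irr W p →
      Summit.BirchSwinnertonDyer.Rank1Residual.Additive.TypeGOrd W p → padicValInt p W.minimalDiscriminantInt ≤ 4 →
      (∀ z ∈ D.L.lattice, ∃ w ∈ periodLattice D.f, z = D.c * w) →
      ∀ (χ : DirichletCharacter ℂ p) (hχ : χ.IsQuadratic), χ.IsPrimitive →
        ∀ z ∈ periodLattice D.f, ∃ w ∈ periodLattice (charTwist (W.conductorNorm ℤ) (dvd_refl _) hsq hχ D.f),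
          z = gaussSum χ (ZMod.stdAddChar (N := p)) * w := by
  intro W _ _ p _ _ D hsq hp5 hadd hirr hGo hV4 hopt χ hχ hprim
  suffices aux : ∀ (N : ℕ) [NeZero N] (_hNN : W.conductorNorm ℤ = N) (D : ModularParametrizationData W N)
      (hsq : p ^ 2 ∣ N), (∀ z ∈ D.L.lattice, ∃ w ∈ periodLattice D.f, z = D.c * w) →
      ∀ z ∈ periodLattice D.f, ∃ w ∈ periodLattice (charTwist N (dvd_refl _) hsq hχ D.f),
        z = gaussSum χ (ZMod.stdAddChar (N := p)) * w from aux _ rfl D hsq hopt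
  intro N _ hNN D' hsq' hopt'
  obtain ⟨M, hM, hpM⟩ := conductorNorm_eq_sq_mul_coprime W p hp5 (hNN ▸ hsq')
  obtain rfl : N = p ^ 2 * M := hNN.symm.trans hM
  haveI : NeZero M := ⟨fun h => NeZero.ne (p ^ 2 * M) (by rw [h, mul_zero])⟩
  haveI : Fintype (diagTorus (ZMod p)) := Fintype.ofFinite _
  haveI : Invertible (Fintype.card (diagTorus (ZMod p)) : ℤ_[p]) := (isUnit_card_diagTorus p).invertible
  letI : Algebra ℤ_[p] (ZMod p) := (PadicInt.toZMod (p := p)).toAlgebra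
  have hsurj : Surjective (algebraMap ℤ_[p] (ZMod p)) := ZMod.ringHom_surjective _
  have halg : ∀ x : ℤ_[p], algebraMap ℤ_[p] (ZMod p) x = ZMod.castHom (dvd_refl p) (ZMod p) (PadicInt.toZMod x) := fun x => by
    rw [ZMod.castHom_self, RingHom.id_apply]; rfl
  have hb : 0 < tameExponent p W := TameExponent.tameExponent_pos W p hp5 hadd hGo hV4
  have hb2 : 2 * tameExponent p W < p - 1 := TameExponent.two_mul_tameExponent_lt W p hp5 hadd hGo hV4
  -- (I1ℚ) at the instance from the type fact, then integral, then Borel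
  obtain ⟨ΨK, hΨK, hΨK0⟩ := exists_ratFunctional_of_tameTypeCentral p M hpM hT W hM D' hp5 hadd hGo hV4
  obtain ⟨Ψ₁, hΨ₁, hΨ₁0⟩ := exists_integral_of_rat p M hpM D'.f _ _ ΨK hΨK hΨK0
  obtain ⟨lam, hlam0, hlamB, hlamK⟩ := exists_borel_of_functional p M hpM D'.f _ _ Ψ₁ hΨ₁ hΨ₁0
  -- the weight exclusion (W‴)₅ at the instance, from the three named facts
  have hW := WeightExclusionFive.eq_zero_of_eigenMap_of_five_le hWt hKr hEd p M W hM hp5 hadd hirr hGo hV4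
  -- the integral carrier functional with its socle clause, and the saturation
  obtain ⟨m, Ψ, hΨ, hm, hsoc⟩ :=
    exists_integralFunctional_of_borel_of_weightExclusion p M hpM W D' hb hb2 lam hlam0 hlamB hlamK hW
  exact saturation_at_of_integralFunctional p M hpM hnf hp5 W hM D' hadd hirr hGo hV4 hopt' χ hχ hprim hsurj halg hb hb2 Ψ hΨ
    hm hsoc

/-- **The Kummer-corner reading of K₅** on CORNER's own binders (`KummerCornerTorsionOptimalManinUnit`, stmt-BirchSwinnertonDyer-23883;
WILD 24306 / TAME 24307): for `W` globally minimal with `(p, ord_pΔ_min) ∈ {(5, 3), (7, 2)}` (Kodaira III at 5 / II at 7, `e = p − 1`,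
tame exponent `b = 1`), additive, `E[p]` irreducible, (G)-ordinary, every lattice-optimal datum `D` at conductor level and the quadratic
character `χ` mod `p`: `Λ(f_D) ⊆ g(χ)·Λ(f_D ⊗ χ)` — granted the five named inputs (the `ℚ_p`-rational `p`-torsion point of the corner is not
used).  This is the transferred PREFIX of the GE11 argument; the corner's Manin unit does NOT follow (last glue step needs Edixhoven 1991
Thm. 3 at `p ≤ 7`, not in print).  BSD is not proved by this. [cite: EdixhovenManin1991, §4] [cite: Kraus1997Dissertationes, Prop. 1] -/
theorem twistedPeriodLatticeSaturation_of_corner_of_named_inputs (hnf : exists_isNewformOf)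
    (hT : fullLevelHomology_isIsotypic_tamePrincipalSeries_of_central)
    (hWt : fullLevelHomology_twist_isModular_of_eigenMap_signed)
    (hKr : Kraus1997.propOne_inertiaShape_of_ordinary) (hEd : edixhoven1992_serreWeight_le_weight_of_newform)
    (W : WeierstrassCurve ℚ) [W.IsElliptic] [W.IsGloballyMinimal] (p : ℕ) [Fact p.Prime] [NeZero (W.conductorNorm ℤ)]
    (D : ModularParametrizationData W (W.conductorNorm ℤ))
    (hcell : (p = 5 ∧ padicValInt p W.minimalDiscriminantInt = 3) ∨ (p = 7 ∧ padicValInt p W.minimalDiscriminantInt = 2))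
    (hadd : Rank1Residual.Addv W p) (hirr : Rank1Residual.Irr W p)
    (hGo : Summit.BirchSwinnertonDyer.Rank1Residual.Additive.TypeGOrd W p)
    (hopt : ∀ z ∈ D.L.lattice, ∃ w ∈ periodLattice D.f, z = D.c * w)
    (χ : DirichletCharacter ℂ p) (hχ : χ.IsQuadratic) (hprim : χ.IsPrimitive) :
    ∃ hsq : p ^ 2 ∣ W.conductorNorm ℤ,
      ∀ z ∈ periodLattice D.f, ∃ w ∈ periodLattice (charTwist (W.conductorNorm ℤ) (dvd_refl _) hsq hχ D.f),
        z = gaussSum χ (ZMod.stdAddChar (N := p)) * w := by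
  have hp5 : 5 ≤ p := by rcases hcell with ⟨rfl, -⟩ | ⟨rfl, -⟩ <;> norm_num
  have hV4 : padicValInt p W.minimalDiscriminantInt ≤ 4 := by rcases hcell with ⟨-, h⟩ | ⟨-, h⟩ <;> omega
  have hsq : p ^ 2 ∣ W.conductorNorm ℤ := sq_dvd_conductorNorm_of_not_good_of_not_mult hadd
  exact ⟨hsq, twistedPeriodLatticeSaturation_five_of_named_inputs hnf hT hWt hKr hEd W p D hsq hp5 hadd hirr hGo hV4 hopt χ hχ hprim⟩

end KFive

end Summit.BirchSwinnertonDyer.BirchSwinnertonDyer.Theorems.TeichmullerTwistDescent
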